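import Summits.HodgeConjecture.CorCM.SexticOcticWeilSixfoldParts
import Summits.HodgeConjecture.CorCM.SexticOcticWeilEightfoldParts
import Summits.HodgeConjecture.CorCM.SexticOcticWeilTenfoldParts
import HarnessLib

/-!
# COR-CM — the Hodge conjecture for every product of copies of `E, T, B` — a CM THREEFOLD of `k`-signature `(1,2)` over a SEXTIC CM field
# `K₁ ⊇ k`, a CM FOURFOLD of `k`-signature `(1,3)` over an OCTIC CM field `K₂ ⊇ k`, and the CM curve `E` of `k` — GIVEN ONLY Markman's
# fourfold theorem and hyperbolic-sixfold theorem (frame form; joint transitivity as a hypothesis, automatic downstream)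

Cell `pub-hodgecm2` (COR-CM), seat b30 gen 26 (2026-08-23); count-neutral own lane SEXTIC-OCTIC — the ASSEMBLY of the chain
`Census/SexticOcticWeil{,Defect,Parts,PartsBalanced,Extraction}` + `CorCM/SexticOcticWeil{FrameTransfer,FourfoldParts,SixfoldSubproduct,
SixfoldParts,EightfoldParts,TenfoldParts}`.  Theorems only; no definition, no named fact, no `sorry`.  HONEST FRAMING: a CONDITIONAL result
for a NAMED class of CM abelian varieties — `HC_CM` is NOT proved and is not mentioned; the displayed deep inputs are exactly the two named
facts `Markman2025_weilClasses_algebraic_abelianFourfold` (Weil classes of `T × E`) and `Markman2025_weilClasses_algebraic_hyperbolicSixfold`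
(Weil classes of `B × E × E`).

THE PROOF.  For `X = ⨁_j A(κ j)`, `κ : Fin N → Fin 3`, every rational Hodge class is a sum of weight classes `H(X)_S` over the
`Aut(ℂ)`-balanced weights `S` (Pohlmann, `Pohlmann1968_thm1_cmAlgebra`); a balanced weight is a balanced configuration of the finite model
under the realised pairs of permutations (`modelBalancedS_of_isGaloisBalancedAlg`, no Galois hypothesis), the realised pairs are jointly
transitive (`hjt`; for coprime relative degrees `3, 4` this is automatic — the sequel `…JointTransitive`), so the configuration is a disjoint
union of parts (`modelBalancedS_induction`): PAIRS (divisor lines), FOUR parts (the Weil class of `T × E`, Markman's fourfold theorem), SIX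
parts (the Weil class of `B × E × E`, Markman's sixfold theorem), EIGHT parts (`Ē × T × B̄`) and TEN parts (`T × T × B̄`) — the last two
reached by push–pull through fresh curves from the four and six parts; algebraic lines are closed under disjoint union (cup product).

* `hodgeConjectureFor_biproduct_comp_of_frames_of_markman` — MAIN THEOREM (frame form); `…_of_avDominatedBy_…` (everything dominated).
[cite: Markman2025SurveySecant, Thm. 1.2] [cite: Markman2025SecantWeil, Thm 1.5.1] [cite: Pohlmann1968, Thm 1]
[cite: Milne2020HodgeClassesAV, 1.2 (a) and Thm. 1] [cite: Schoen1998HodgeWeilAddendum, §10] [cite: MumfordAV1970, §19]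

## References
* [Markman2025SurveySecant] E. Markman, arXiv:2509.23403, Thm. 1.2.  [Markman2025SecantWeil] E. Markman, arXiv:2502.03415, Thm. 1.5.1.
  [Pohlmann1968] H. Pohlmann, Ann. of Math. 88 (1968), Thm 1.  [Milne2020HodgeClassesAV] J. S. Milne, arXiv:2010.08857, 1.2 (a), Thm. 1.
  [Schoen1998HodgeWeilAddendum] C. Schoen, Compositio Math. 114 (1998), §10.  [MumfordAV1970] D. Mumford, *Abelian Varieties*, §19.
-/

noncomputable section

open CategoryTheory CategoryTheory.Limits NumberField

namespace Summit.HodgeConjecture.CorCM.SexticOcticWeil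

open Literature.AlgebraicGeometry Literature.AlgebraicGeometry.Motives Literature.AlgebraicGeometry.HodgeTheory
open Literature.AlgebraicGeometry.ComplexMultiplication (IsCMTypeRealisation)
open Literature.AlgebraicGeometry.Pohlmann1968
open Literature.AlgebraicTopology.SingularHomology
open Literature.NumberTheory.ComplexMultiplication
open Summit.HodgeConjecture.CorCM.Census.SexticOcticWeil (PtS ModelBalancedS IsPairPartS IsFourPartS IsSixPartS IsEightPartS IsTenPartS
  JointTransitive modelBalancedS_induction)
open Summit.HodgeConjecture.CorCM.DecicWeil23Pair (ext₂)
open Summit.HodgeConjecture.CorCM.PairWeights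

open scoped Classical Pointwise

section Assembly

variable {I : Type} {Kf : I → Type} [∀ i, Field (Kf i)] [∀ i, NumberField (Kf i)] [∀ i, IsCMField (Kf i)]
  {i₀ i₁ i₂ : I} {τ : Kf i₀ →+* ℂ}
  {A : Fin 3 → AbelianVariety ℂ} {Φ : ∀ j : Fin 3, CMType (Kf (soSlots i₀ i₁ i₂ j))}
  {ι : ∀ j, 𝓞 (Kf (soSlots i₀ i₁ i₂ j)) →+* End (A j)}
  {θ : ∀ j, Kf (soSlots i₀ i₁ i₂ j) →+* Module.End ℂ (complexBetti (A j).X 1)}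

/-- **MAIN THEOREM (frame form).  The Hodge conjecture for every product of copies `⨁_j A(κ j)` of `E, T, B` — i.e. for `E^a × T^n × B^m`,
all exponents, any order — GIVEN ONLY Markman's fourfold theorem (the Weil classes of `T × E`) and hyperbolic-sixfold theorem (the Weil
classes of `B × E × E`)**, for `E ⊨ (k; {τ})` (`δ ∈ 𝓞_k`, `δ² = −d`, `τ(δ) = i√d`), `T ⊨ (K₁; Φ 1)` a CM threefold over a SEXTIC CM field
`K₁ ⊇ i₁(k)` whose type has exactly one member over `τ`, read at position `0` of a frame `e₁` (`hΦ₁`), and `B ⊨ (K₂; Φ 2)` a CM fourfold over an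
OCTIC CM field `K₂ ⊇ i₂(k)` whose type has exactly one member over `τ`, read at position `0` of a frame `e₂` (`hΦ₂`), under JOINT TRANSITIVITY
`hjt`: every pair of embeddings `(x, y)` over `τ` is moved to the base pair by ONE automorphism of `ℂ` (automatic: `…JointTransitive`).
Leaves: the two Markman facts ONLY. [cite: Markman2025SurveySecant, Thm. 1.2] [cite: Markman2025SecantWeil, Thm 1.5.1] [cite: Pohlmann1968, Thm 1]
[cite: Milne2020HodgeClassesAV, 1.2 (a) and Thm. 1] [cite: Schoen1998HodgeWeilAddendum, §10] -/
theorem hodgeConjectureFor_biproduct_comp_of_frames_of_markman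
    (hW4 : Markman2025_weilClasses_algebraic_abelianFourfold) (hM6 : Markman2025_weilClasses_algebraic_hyperbolicSixfold)
    {N : ℕ} (κ : Fin N → Fin 3) (h6 : Module.finrank ℚ (Kf i₁) = 6) (h8 : Module.finrank ℚ (Kf i₂) = 8)
    (h2 : Module.finrank ℚ (Kf i₀) = 2) (i₁' : Kf i₀ →+* Kf i₁) (i₂' : Kf i₀ →+* Kf i₂)
    {δ : 𝓞 (Kf i₀)} {d : ℕ} (hd : 0 < d) (hδ : ((δ : Kf i₀)) ^ 2 = -(d : Kf i₀)) (hτ : τ (δ : Kf i₀) = Complex.I * (Real.sqrt d : ℂ))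
    (hA : ∀ j, IsCMTypeRealisation (Φ j) (A j) (ι j) (θ j))
    (e₁ : (Kf i₁ →+* ℂ) ≃ Fin 3 × Bool) (e₂ : (Kf i₂ →+* ℂ) ≃ Fin 4 × Bool)
    (he₁_sign : ∀ s : Kf i₁ →+* ℂ, (e₁ s).2 = true ↔ s.comp i₁' = τ)
    (he₂_sign : ∀ t : Kf i₂ →+* ℂ, (e₂ t).2 = true ↔ t.comp i₂' = τ)
    (he₁_conj : ∀ s : Kf i₁ →+* ℂ, e₁ (ComplexEmbedding.conjugate s) = ((e₁ s).1, !(e₁ s).2))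
    (he₂_conj : ∀ t : Kf i₂ →+* ℂ, e₂ (ComplexEmbedding.conjugate t) = ((e₂ t).1, !(e₂ t).2))
    (hΨ : ∀ σ : Kf i₀ →+* ℂ, σ ∈ (Φ 0).1 ↔ σ = τ)
    (hΦ₁ : ∀ s : Kf i₁ →+* ℂ, s ∈ (Φ 1).1 ↔ (e₁ s).2 = decide ((e₁ s).1 = 0))
    (hΦ₂ : ∀ t : Kf i₂ →+* ℂ, t ∈ (Φ 2).1 ↔ (e₂ t).2 = decide ((e₂ t).1 = 0))
    (hjt : ∀ (x : Fin 3) (y : Fin 4), ∃ ρ : ℂ ≃+* ℂ,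
      (ρ : ℂ →+* ℂ).comp (e₁.symm (x, true)) = e₁.symm (0, true) ∧ (ρ : ℂ →+* ℂ).comp (e₂.symm (y, true)) = e₂.symm (0, true)) :
    HodgeConjectureFor (⨁ fun j => A (κ j)).dim (⨁ fun j => A (κ j)).X := by
  have hττ : ComplexEmbedding.conjugate τ ≠ τ := QuarticCM.conjugate_ne τ
  have hk : ∀ σ : Kf i₀ →+* ℂ, σ = τ ∨ σ = ComplexEmbedding.conjugate τ := fun σ =>
    QuarticCM.eq_or_eq_conjugate_of_quadratic h2 τ σ
  -- the realised pairs are jointly transitive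
  have hjt' : JointTransitive (realisedPairs e₁ e₂) := jointTransitive_realisedPairs he₁_sign he₂_sign hjt
  -- the Weil planes of `T ⊞ E` and `(B × E) × E`, algebraic by Markman's theorems
  have hW₂ := weilClassesOf_fourfold_le_algebraicClasses_of_frameS_of_markman (i₂ := i₂) hW4 h6 h2 i₁' hd hδ hA he₁_sign hΦ₁ hΨ
  have hW₃ := weilClassesOf_sixfold_le_algebraicClasses_of_frameS_of_markmanSixfold (i₁ := i₁) hM6 h8 h2 i₂' hd hδ hA he₂_sign hΦ₂ hΨ
  -- four and six parts of any product of copies (used on `X` and on `X⁺ = E² ⊞ X`, `E⁴ ⊞ X`)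
  have hfour : ∀ {N' : ℕ} (κ' : Fin N' → Fin 3) (c : Bool) (G' : Finset ((j : Fin N') × (Kf (soSlots i₀ i₁ i₂ (κ' j)) →+* ℂ))),
      IsFourPartS (fun x => toPtS e₁ e₂ τ ((Sigma.map κ' (fun _ => id) :
        ((j : Fin N') × (Kf (soSlots i₀ i₁ i₂ (κ' j)) →+* ℂ)) → ((l : Fin 3) × (Kf (soSlots i₀ i₁ i₂ l) →+* ℂ))) x)) c G' →
      G'.card = 2 * 2 ∧ weightClassesAlg (fun j => A (κ' j)) (fun j => ι (κ' j)) (2 * 2) G' ≤ algebraicClasses (⨁ fun j => A (κ' j)).X 2 :=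
    fun κ' c G' hG' => weightClassesAlg_le_algebraicClasses_of_isFourPartS κ' hk he₁_sign he₂_sign hA hτ hW₂ hG'
  have hsix : ∀ {N' : ℕ} (κ' : Fin N' → Fin 3) (c : Bool) (G' : Finset ((j : Fin N') × (Kf (soSlots i₀ i₁ i₂ (κ' j)) →+* ℂ))),
      IsSixPartS (fun x => toPtS e₁ e₂ τ ((Sigma.map κ' (fun _ => id) :
        ((j : Fin N') × (Kf (soSlots i₀ i₁ i₂ (κ' j)) →+* ℂ)) → ((l : Fin 3) × (Kf (soSlots i₀ i₁ i₂ l) →+* ℂ))) x)) c G' →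
      G'.card = 2 * 3 ∧ weightClassesAlg (fun j => A (κ' j)) (fun j => ι (κ' j)) (2 * 3) G' ≤ algebraicClasses (⨁ fun j => A (κ' j)).X 3 :=
    fun κ' c G' hG' => weightClassesAlg_le_algebraicClasses_of_isSixPartS hk he₁_sign he₂_sign hA hτ hW₃ κ' hG'
  refine ⟨nonempty_hodgeModel_holds (Motives.AbelianVariety.isSmoothProjective_holds (A := ⨁ fun j => A (κ j))),
    fun p cl hc hH => ?_⟩
  have hAκ : ∀ j, IsCMTypeRealisation (Φ (κ j)) (A (κ j)) (ι (κ j)) (θ (κ j)) := fun j => hA (κ j)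
  -- every balanced configuration has algebraic weight lines: induct over its parts
  have key : ∀ (S : Finset ((j : Fin N) × (Kf (soSlots i₀ i₁ i₂ (κ j)) →+* ℂ))),
      ModelBalancedS (realisedPairs e₁ e₂) (fun x => toPtS e₁ e₂ τ ((Sigma.map κ (fun _ => id) :
        ((j : Fin N) × (Kf (soSlots i₀ i₁ i₂ (κ j)) →+* ℂ)) → ((m : Fin 3) × (Kf (soSlots i₀ i₁ i₂ m) →+* ℂ))) x)) S →
      ∀ q, S.card = 2 * q → weightClassesAlg (fun j => A (κ j)) (fun j => ι (κ j)) (2 * q) S ≤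
        algebraicClasses (⨁ fun j => A (κ j)).X q := by
    intro S hS
    refine modelBalancedS_induction hjt' (motive := fun S => ∀ q, S.card = 2 * q →
      weightClassesAlg (fun j => A (κ j)) (fun j => ι (κ j)) (2 * q) S ≤ algebraicClasses (⨁ fun j => A (κ j)).X q)
      (fun q hq => ?_) (fun G S' hGS hG ih q hq => ?_) (fun G S' b hGS hG ih q hq => ?_) (fun G S' b hGS hG ih q hq => ?_)
      (fun G S' b hGS hG ih q hq => ?_) (fun G S' b hGS hG ih q hq => ?_) hS
    · obtain rfl : q = 0 := by simpa using hq.symm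
      exact fun c' _ => hodgeConjectureFor_codim_zero c'
    · -- a pair part: a divisor line
      obtain ⟨ha, hGalg⟩ := weightClassesAlg_le_algebraicClasses_of_isPairPartS κ hττ hk he₁_conj he₂_conj hA hG
      have hRcard : S'.card = 2 * (q - 1) := by
        have h := Finset.card_union_of_disjoint hGS; rw [hq, ha] at h; omega
      have haq : 1 + (q - 1) = q := by
        have h := Finset.card_union_of_disjoint hGS; rw [hq, ha] at h; omega
      rw [← Finset.disjUnion_eq_union G S' hGS]
      exact weightClassesAlg_union_le_algebraicClasses hAκ haq ha hRcard hGS hGalg (ih (q - 1) hRcard)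
    · -- a four part: the Weil class of `T × E`, Markman's fourfold theorem
      obtain ⟨ha, hGalg⟩ := hfour κ b G hG
      have hRcard : S'.card = 2 * (q - 2) := by
        have h := Finset.card_union_of_disjoint hGS; rw [hq, ha] at h; omega
      have haq : 2 + (q - 2) = q := by
        have h := Finset.card_union_of_disjoint hGS; rw [hq, ha] at h; omega
      rw [← Finset.disjUnion_eq_union G S' hGS]
      exact weightClassesAlg_union_le_algebraicClasses hAκ haq ha hRcard hGS hGalg (ih (q - 2) hRcard)
    · -- a six part: the Weil class of `B × E × E`, Markman's sixfold theorem
      obtain ⟨ha, hGalg⟩ := hsix κ b G hG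
      have hRcard : S'.card = 2 * (q - 3) := by
        have h := Finset.card_union_of_disjoint hGS; rw [hq, ha] at h; omega
      have haq : 3 + (q - 3) = q := by
        have h := Finset.card_union_of_disjoint hGS; rw [hq, ha] at h; omega
      rw [← Finset.disjUnion_eq_union G S' hGS]
      exact weightClassesAlg_union_le_algebraicClasses hAκ haq ha hRcard hGS hGalg (ih (q - 3) hRcard)
    · -- an eight part `Ē × T × B̄`: push-pull through `E² ⊞ X`
      obtain ⟨ha, hGalg⟩ := weightClassesAlg_le_algebraicClasses_of_isEightPartS κ hττ hk he₁_conj he₂_conj hA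
        (fun c G' hG' => (hfour (ext₂ κ) c G' hG').2) (fun c G' hG' => (hsix (ext₂ κ) c G' hG').2) hG
      have hRcard : S'.card = 2 * (q - 4) := by
        have h := Finset.card_union_of_disjoint hGS; rw [hq, ha] at h; omega
      have haq : 4 + (q - 4) = q := by
        have h := Finset.card_union_of_disjoint hGS; rw [hq, ha] at h; omega
      rw [← Finset.disjUnion_eq_union G S' hGS]
      exact weightClassesAlg_union_le_algebraicClasses hAκ haq ha hRcard hGS hGalg (ih (q - 4) hRcard)
    · -- a ten part `T × T × B̄`: push-pull through `E⁴ ⊞ X`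
      obtain ⟨ha, hGalg⟩ := weightClassesAlg_le_algebraicClasses_of_isTenPartS κ hττ hk he₁_conj he₂_conj hA
        (fun c G' hG' => (hfour (extS₄ κ) c G' hG').2) (fun c G' hG' => (hsix (extS₄ κ) c G' hG').2) hG
      have hRcard : S'.card = 2 * (q - 5) := by
        have h := Finset.card_union_of_disjoint hGS; rw [hq, ha] at h; omega
      have haq : 5 + (q - 5) = q := by
        have h := Finset.card_union_of_disjoint hGS; rw [hq, ha] at h; omega
      rw [← Finset.disjUnion_eq_union G S' hGS]
      exact weightClassesAlg_union_le_algebraicClasses hAκ haq ha hRcard hGS hGalg (ih (q - 5) hRcard)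
  have hmem : cl ∈ ⨆ S ∈ pohlmannSetsAlg (K := fun j => Kf (soSlots i₀ i₁ i₂ (κ j))) (fun j => Φ (κ j)) p,
      weightClassesAlg (fun j => A (κ j)) (fun j => ι (κ j)) (2 * p) S := by
    rw [← (Pohlmann1968_thm1_cmAlgebra (fun j => Kf (soSlots i₀ i₁ i₂ (κ j))) (fun j => A (κ j))
      (fun j => Φ (κ j)) (fun j => ι (κ j)) (fun j => θ (κ j)) hAκ p).1]
    exact Submodule.subset_span ⟨hc, hH⟩
  have hle : (⨆ S ∈ pohlmannSetsAlg (K := fun j => Kf (soSlots i₀ i₁ i₂ (κ j))) (fun j => Φ (κ j)) p,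
      weightClassesAlg (fun j => A (κ j)) (fun j => ι (κ j)) (2 * p) S) ≤
      algebraicClasses (⨁ fun j => A (κ j)).X p := by
    refine iSup₂_le fun S hS => ?_
    exact key S (modelBalancedS_of_isGaloisBalancedAlg hττ hk he₁_sign he₁_conj he₂_conj hΨ hΦ₁ hΦ₂ κ hS.2) p hS.1
  exact hle hmem

/-- **The Hodge conjecture for every abelian variety dominated by a product of copies `⨁_j A(κ j)` of `E, T, B`** (frame form, joint
transitivity, modulo Markman's two theorems): every abelian variety isogenous to a product of copies of `E, T, B` and their abelian
subvarieties and quotients. [cite: Markman2025SurveySecant, Thm. 1.2] [cite: Markman2025SecantWeil, Thm 1.5.1] [cite: MumfordAV1970, §19] -/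
theorem hodgeConjectureFor_of_avDominatedBy_comp_of_frames_of_markman
    (hW4 : Markman2025_weilClasses_algebraic_abelianFourfold) (hM6 : Markman2025_weilClasses_algebraic_hyperbolicSixfold)
    {N : ℕ} (κ : Fin N → Fin 3) (h6 : Module.finrank ℚ (Kf i₁) = 6) (h8 : Module.finrank ℚ (Kf i₂) = 8)
    (h2 : Module.finrank ℚ (Kf i₀) = 2) (i₁' : Kf i₀ →+* Kf i₁) (i₂' : Kf i₀ →+* Kf i₂)
    {δ : 𝓞 (Kf i₀)} {d : ℕ} (hd : 0 < d) (hδ : ((δ : Kf i₀)) ^ 2 = -(d : Kf i₀)) (hτ : τ (δ : Kf i₀) = Complex.I * (Real.sqrt d : ℂ))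
    (hA : ∀ j, IsCMTypeRealisation (Φ j) (A j) (ι j) (θ j))
    (e₁ : (Kf i₁ →+* ℂ) ≃ Fin 3 × Bool) (e₂ : (Kf i₂ →+* ℂ) ≃ Fin 4 × Bool)
    (he₁_sign : ∀ s : Kf i₁ →+* ℂ, (e₁ s).2 = true ↔ s.comp i₁' = τ)
    (he₂_sign : ∀ t : Kf i₂ →+* ℂ, (e₂ t).2 = true ↔ t.comp i₂' = τ)
    (he₁_conj : ∀ s : Kf i₁ →+* ℂ, e₁ (ComplexEmbedding.conjugate s) = ((e₁ s).1, !(e₁ s).2))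
    (he₂_conj : ∀ t : Kf i₂ →+* ℂ, e₂ (ComplexEmbedding.conjugate t) = ((e₂ t).1, !(e₂ t).2))
    (hΨ : ∀ σ : Kf i₀ →+* ℂ, σ ∈ (Φ 0).1 ↔ σ = τ)
    (hΦ₁ : ∀ s : Kf i₁ →+* ℂ, s ∈ (Φ 1).1 ↔ (e₁ s).2 = decide ((e₁ s).1 = 0))
    (hΦ₂ : ∀ t : Kf i₂ →+* ℂ, t ∈ (Φ 2).1 ↔ (e₂ t).2 = decide ((e₂ t).1 = 0))
    (hjt : ∀ (x : Fin 3) (y : Fin 4), ∃ ρ : ℂ ≃+* ℂ,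
      (ρ : ℂ →+* ℂ).comp (e₁.symm (x, true)) = e₁.symm (0, true) ∧ (ρ : ℂ →+* ℂ).comp (e₂.symm (y, true)) = e₂.symm (0, true))
    {X : AbelianVariety ℂ} (hX : Domination.AVDominatedBy X (⨁ fun j => A (κ j))) :
    HodgeConjectureFor X.dim X.X :=
  Domination.hodgeConjectureFor_of_avDominatedBy
    (hodgeConjectureFor_biproduct_comp_of_frames_of_markman hW4 hM6 κ h6 h8 h2 i₁' i₂' hd hδ hτ hA e₁ e₂ he₁_sign he₂_sign he₁_conj he₂_conj
      hΨ hΦ₁ hΦ₂ hjt) hX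

end Assembly

end Summit.HodgeConjecture.CorCM.SexticOcticWeil

end
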